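import Mathlib
import HarnessLib
import Literature.Computability.AlgebraicComplexity.ArithCircuit
import Literature.Computability.AlgebraicComplexity.SupportSymmetrisation
import Summits.ValiantsHypothesis.ValiantsHypothesis.Theorems.MonotoneRestorationMonotoneRestorationQPRowScanGates

/-!
# ValiantsHypothesis / MonotoneRestoration — `MonotoneRestorationQP`, block-monomial gadgets (1/2)

Support file for crux item `stmt-ValiantsHypothesis-15886` (crux `MonotoneRestorationQP`),
stub `stub_monotoneSupportReduction`, quasi-polynomially SPARSE regime (TTRL-lite variant V20164,
`…QPVariants20164.lean`): gadgets for building SUPPORTED STRAIGHT-LINE PROGRAMS (annotated gate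
lists, the input format of `SupportSymm.exists_symmetric_circuit_of_supports`) of an arbitrary
support WIDTH `w` (the tree's `rowScanGates_step` is `w = 2`): the extension lemmas
`blockGadgets_step` / `blockGadgets_step_hered`, and, for an abstract invariant `Inv` closed under
them, `blockGadgets_equivSum` (the full sum of an EQUIVARIANT located family, located at the
support whose pointwise stabiliser permutes the family) and
`blockGadgets_newton` (Newton's recursion `(k+1) E_{k+1} = Σ_{i≤k} (-1)^i E_{k-i} P_i` as at most
`(N+1)²` hereditary gates; registered sub-goal `blockGadgets_newton_located`). No definitions.
References: P. Bürgisser, *Completeness and Reduction in Algebraic Complexity Theory* (2000),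
Def. 2.1; I. G. Macdonald, *Symmetric Functions and Hall Polynomials* (1995), I.(2.11').
-/

-- `Summit.ValiantsHypothesis.ValiantsHypothesis.…` is the tree's mandated single-conjunct layout
-- (Sub = Summit), so the duplicated namespace component is intended.
set_option linter.dupNamespace false

open Literature.Computability.AlgebraicComplexity MvPolynomial

namespace Summit.ValiantsHypothesis.ValiantsHypothesis.Theorems

/-! ### The invariant extension lemma at width `w` -/

/-- **Invariant extension, width `w`.** The six hypotheses of
`SupportSymm.exists_symmetric_circuit_of_supports` (non-nullary gates, fan-in `≤ A`, well formed,
supports of size `≤ w`, hereditary supports of product gates, gate values invariant under the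
diagonal renamings fixing their support pointwise) pass from `(L, K)` to
`(L ++ [g], K[|L| ↦ S])` for a non-nullary gate `g` of fan-in `≤ A` referring to gates `< |L|`,
with `|S| ≤ w`, operands supported inside `S` if `g` is a product gate, and value invariant
under the renamings fixing `S` pointwise. [folklore] -/
theorem blockGadgets_step {k : Type*} [CommSemiring k] {n : ℕ} (A w : ℕ)
    (L : List (ArithCircuit.Gate k (Fin n × Fin n))) (K : ℕ → Finset (Fin n))
    (g : ArithCircuit.Gate k (Fin n × Fin n)) (S : Finset (Fin n))
    (h1 : ∀ g ∈ L, g.args ≠ []) (h2 : ∀ g ∈ L, g.fanIn ≤ A)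
    (h3 : ∀ (i : ℕ) (g : ArithCircuit.Gate k (Fin n × Fin n)), L[i]? = some g →
      ∀ u ∈ g.args, u.RefsBelow i)
    (h4 : ∀ i, (K i).card ≤ w)
    (h5 : ∀ (i : ℕ) (us : List (ArithCircuit.Operand k (Fin n × Fin n))),
      L[i]? = some (.prod us) → ∀ u ∈ us, SupportSymm.osupp K u ⊆ K i)
    (h6 : ∀ (i : ℕ) (σ : Equiv.Perm (Fin n)), i < L.length → (∀ x ∈ K i, σ x = x) →
      rename (fun pq : Fin n × Fin n => (σ pq.1, σ pq.2)) ((ArithCircuit.gateValues L).getD i 0) =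
        (ArithCircuit.gateValues L).getD i 0)
    (hg1 : g.args ≠ []) (hg2 : g.fanIn ≤ A) (hg3 : ∀ u ∈ g.args, u.RefsBelow L.length)
    (hS : S.card ≤ w) (hg5 : ∀ us, g = .prod us → ∀ u ∈ us, SupportSymm.osupp K u ⊆ S)
    (hg6 : ∀ σ : Equiv.Perm (Fin n), (∀ x ∈ S, σ x = x) →
      rename (fun pq : Fin n × Fin n => (σ pq.1, σ pq.2)) (g.eval (ArithCircuit.gateValues L)) =
        g.eval (ArithCircuit.gateValues L)) :
    (∀ g' ∈ L ++ [g], g'.args ≠ []) ∧ (∀ g' ∈ L ++ [g], g'.fanIn ≤ A) ∧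
      (∀ (i : ℕ) (g' : ArithCircuit.Gate k (Fin n × Fin n)), (L ++ [g])[i]? = some g' →
        ∀ u ∈ g'.args, u.RefsBelow i) ∧
      (∀ i, (Function.update K L.length S i).card ≤ w) ∧
      (∀ (i : ℕ) (us : List (ArithCircuit.Operand k (Fin n × Fin n))),
        (L ++ [g])[i]? = some (.prod us) →
          ∀ u ∈ us, SupportSymm.osupp (Function.update K L.length S) u ⊆
            Function.update K L.length S i) ∧
      (∀ (i : ℕ) (σ : Equiv.Perm (Fin n)), i < (L ++ [g]).length →
        (∀ x ∈ Function.update K L.length S i, σ x = x) →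
          rename (fun pq : Fin n × Fin n => (σ pq.1, σ pq.2))
            ((ArithCircuit.gateValues (L ++ [g])).getD i 0) =
            (ArithCircuit.gateValues (L ++ [g])).getD i 0) := by
  refine ⟨?_, ?_, ?_, ?_, ?_, ?_⟩
  · intro g' hg'
    rw [List.mem_append, List.mem_singleton] at hg'
    rcases hg' with hg' | rfl
    exacts [h1 g' hg', hg1]
  · intro g' hg'
    rw [List.mem_append, List.mem_singleton] at hg'
    rcases hg' with hg' | rfl
    exacts [h2 g' hg', hg2]
  · intro i g' hg'
    rcases rowScanGates_getElem?_append_singleton hg' with ⟨-, hg'⟩ | ⟨rfl, rfl⟩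
    exacts [h3 i g' hg', hg3]
  · intro i
    by_cases hi : i = L.length
    · subst hi
      rwa [Function.update_self]
    · rw [Function.update_of_ne hi]
      exact h4 i
  · intro i us hus u hu
    rcases rowScanGates_getElem?_append_singleton hus with ⟨hi, hus⟩ | ⟨rfl, hgus⟩
    · rw [Function.update_of_ne (Nat.ne_of_lt hi), rowScanGates_osupp_update K L.length S
        (rowScanGates_refsBelow_mono (h3 i _ hus u hu) hi.le)]
      exact h5 i us hus u hu
    · rw [Function.update_self, rowScanGates_osupp_update K L.length S (hg3 u (hgus ▸ hu))]
      exact hg5 us hgus.symm u hu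
  · intro i σ hi hσ
    rcases Nat.lt_succ_iff_lt_or_eq.1 (by simpa using hi) with hi | rfl
    · rw [Function.update_of_ne (Nat.ne_of_lt hi)] at hσ
      rw [rowScanGates_getD_eq_of_prefix (List.prefix_append L [g]) hi]
      exact h6 i σ hi hσ
    · rw [Function.update_self] at hσ
      rw [(rowScanGates_append L K g S).2.2.2.2.2]
      exact hg6 σ hσ

/-- **Hereditary extension, width `w`.** If ALL operands of the new gate are supported inside
`S`, its value is automatically invariant under the renamings fixing `S` pointwise, so the six
hypotheses pass to `(L ++ [g], K[|L| ↦ S])`. [folklore] -/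
theorem blockGadgets_step_hered {k : Type*} [CommSemiring k] {n : ℕ} (A w : ℕ)
    (L : List (ArithCircuit.Gate k (Fin n × Fin n))) (K : ℕ → Finset (Fin n))
    (g : ArithCircuit.Gate k (Fin n × Fin n)) (S : Finset (Fin n))
    (h1 : ∀ g ∈ L, g.args ≠ []) (h2 : ∀ g ∈ L, g.fanIn ≤ A)
    (h3 : ∀ (i : ℕ) (g : ArithCircuit.Gate k (Fin n × Fin n)), L[i]? = some g →
      ∀ u ∈ g.args, u.RefsBelow i)
    (h4 : ∀ i, (K i).card ≤ w)
    (h5 : ∀ (i : ℕ) (us : List (ArithCircuit.Operand k (Fin n × Fin n))),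
      L[i]? = some (.prod us) → ∀ u ∈ us, SupportSymm.osupp K u ⊆ K i)
    (h6 : ∀ (i : ℕ) (σ : Equiv.Perm (Fin n)), i < L.length → (∀ x ∈ K i, σ x = x) →
      rename (fun pq : Fin n × Fin n => (σ pq.1, σ pq.2)) ((ArithCircuit.gateValues L).getD i 0) =
        (ArithCircuit.gateValues L).getD i 0)
    (hg1 : g.args ≠ []) (hg2 : g.fanIn ≤ A) (hg3 : ∀ u ∈ g.args, u.RefsBelow L.length)
    (hS : S.card ≤ w) (hg4 : ∀ u ∈ g.args, SupportSymm.osupp K u ⊆ S) :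
    (∀ g' ∈ L ++ [g], g'.args ≠ []) ∧ (∀ g' ∈ L ++ [g], g'.fanIn ≤ A) ∧
      (∀ (i : ℕ) (g' : ArithCircuit.Gate k (Fin n × Fin n)), (L ++ [g])[i]? = some g' →
        ∀ u ∈ g'.args, u.RefsBelow i) ∧
      (∀ i, (Function.update K L.length S i).card ≤ w) ∧
      (∀ (i : ℕ) (us : List (ArithCircuit.Operand k (Fin n × Fin n))),
        (L ++ [g])[i]? = some (.prod us) →
          ∀ u ∈ us, SupportSymm.osupp (Function.update K L.length S) u ⊆
            Function.update K L.length S i) ∧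
      (∀ (i : ℕ) (σ : Equiv.Perm (Fin n)), i < (L ++ [g]).length →
        (∀ x ∈ Function.update K L.length S i, σ x = x) →
          rename (fun pq : Fin n × Fin n => (σ pq.1, σ pq.2))
            ((ArithCircuit.gateValues (L ++ [g])).getD i 0) =
            (ArithCircuit.gateValues (L ++ [g])).getD i 0) :=
  blockGadgets_step A w L K g S h1 h2 h3 h4 h5 h6 hg1 hg2 hg3 hS
    (fun _ hus u hu => hg4 u (hus ▸ hu))
    (fun σ hσ => rowScanGates_gate_rename _ _ g fun u hu =>
      rowScanGates_operand_rename L K h6 (hg3 u hu) (hg4 u hu) σ hσ)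

/-! ### Gadgets for an abstract invariant of width `w` -/

section Gadgets

variable {n : ℕ} (A w : ℕ)
  (Inv : List (ArithCircuit.Gate ℂ (Fin n × Fin n)) → (ℕ → Finset (Fin n)) → Prop)
  (hcore : ∀ (L : List (ArithCircuit.Gate ℂ (Fin n × Fin n))) (K : ℕ → Finset (Fin n))
    (g : ArithCircuit.Gate ℂ (Fin n × Fin n)) (S : Finset (Fin n)), Inv L K → g.args ≠ [] →
    g.fanIn ≤ A → (∀ u ∈ g.args, u.RefsBelow L.length) → S.card ≤ w →
    (∀ us, g = .prod us → ∀ u ∈ us, SupportSymm.osupp K u ⊆ S) →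
    (∀ σ : Equiv.Perm (Fin n), (∀ x ∈ S, σ x = x) →
      rename (fun pq : Fin n × Fin n => (σ pq.1, σ pq.2)) (g.eval (ArithCircuit.gateValues L)) =
        g.eval (ArithCircuit.gateValues L)) →
    Inv (L ++ [g]) (Function.update K L.length S))
  (hhered : ∀ (L : List (ArithCircuit.Gate ℂ (Fin n × Fin n))) (K : ℕ → Finset (Fin n))
    (g : ArithCircuit.Gate ℂ (Fin n × Fin n)) (S : Finset (Fin n)), Inv L K → g.args ≠ [] →
    g.fanIn ≤ A → (∀ u ∈ g.args, u.RefsBelow L.length) → S.card ≤ w →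
    (∀ u ∈ g.args, SupportSymm.osupp K u ⊆ S) → Inv (L ++ [g]) (Function.update K L.length S))

include hcore in
/-- **The full sum of an equivariant family.** If `v_0, …, v_{n-1}` are located in `(L, K)`
(at arbitrary supports) and renaming by any permutation `σ` fixing `S₀` pointwise carries `v_j`
to `v_{σ j}`, then one sum gate `Σ_j v_j` (fan-in `n + 1`, with a dummy operand `0 • C 0`)
located at support `S₀` keeps the invariant: its value is fixed by reindexing the sum.
[folklore] -/
theorem blockGadgets_equivSum (hAn : n + 1 ≤ A) (S₀ : Finset (Fin n)) (hS₀ : S₀.card ≤ w)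
    (v : Fin n → MvPolynomial (Fin n × Fin n) ℂ)
    (hv : ∀ σ : Equiv.Perm (Fin n), (∀ x ∈ S₀, σ x = x) → ∀ j,
      rename (fun pq : Fin n × Fin n => (σ pq.1, σ pq.2)) (v j) = v (σ j))
    (L : List (ArithCircuit.Gate ℂ (Fin n × Fin n))) (K : ℕ → Finset (Fin n)) (tab : Fin n → ℕ)
    (htab : ∀ j, tab j < L.length ∧ (ArithCircuit.gateValues L).getD (tab j) 0 = v j)
    (hInv : Inv L K) :
    ∃ (L' : List (ArithCircuit.Gate ℂ (Fin n × Fin n))) (K' : ℕ → Finset (Fin n)), L <+: L' ∧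
      (∀ t < L.length, K' t = K t) ∧ L'.length ≤ L.length + 1 ∧ Inv L' K' ∧
      ∃ t < L'.length, K' t = S₀ ∧ (ArithCircuit.gateValues L').getD t 0 = ∑ j, v j := by
  obtain ⟨hp, ha, hl, hlt, hK, hv'⟩ := rowScanGates_append L K
    (.sum (((0 : ℂ), .const 0) :: List.ofFn fun j : Fin n => ((1 : ℂ), .gate (tab j)))) S₀
  have hval : (ArithCircuit.Gate.sum (((0 : ℂ), .const 0) ::
      List.ofFn fun j : Fin n => ((1 : ℂ), .gate (tab j)))).eval (ArithCircuit.gateValues L) =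
      ∑ j, v j := by
    simp only [ArithCircuit.Gate.eval, List.map_cons, List.map_ofFn, List.sum_cons, zero_smul,
      zero_add, List.sum_ofFn, Function.comp_apply, one_smul, ArithCircuit.Operand.eval_gate]
    exact Finset.sum_congr rfl fun j _ => (htab j).2
  refine ⟨_, _, hp, ha, hl, hcore L K _ _ hInv (by simp [ArithCircuit.Gate.args]) ?_ ?_ hS₀
    (by rintro us ⟨⟩) ?_, L.length, hlt, hK, by rw [hv', hval]⟩
  · simpa [ArithCircuit.Gate.fanIn, ArithCircuit.Gate.args] using hAn
  · intro u hu
    simp only [ArithCircuit.Gate.args, List.map_cons, List.map_ofFn, List.mem_cons,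
      List.mem_ofFn, Function.comp_apply] at hu
    rcases hu with rfl | ⟨j, rfl⟩
    · trivial
    · exact (htab j).1
  · intro σ hσ
    rw [hval, map_sum]
    simp only [hv σ hσ]
    exact Equiv.sum_comp σ v

include hhered in
/-- **Newton's recursion as gates.** Let `E_0 = 1` and
`(k + 1) E_{k+1} = Σ_{i ≤ k} (-1)^i E_{k-i} P_i` for `k < N` (Newton's identities with
`P_i = p_{i+1}`). If `P_0, …, P_{N-1}` are located in `(L, K)` at a common support `S₀`
(`|S₀| ≤ w`), then at most `(N + 1)²` more gates, all hereditary at support `S₀`, locate `E_N`: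
the constant gate `E_0`, and for each `m < N` the `m + 1` product gates `E_{m-i} · P_i` and the
weighted sum gate `E_{m+1} = Σ_i ((-1)^i / (m+1)) · (E_{m-i} P_i)`.
[cite: Macdonald1995, I.(2.11')] -/
theorem blockGadgets_newton (N : ℕ) (hAN : N + 2 ≤ A) (S₀ : Finset (Fin n)) (hS₀ : S₀.card ≤ w)
    (E P : ℕ → MvPolynomial (Fin n × Fin n) ℂ) (h0 : E 0 = 1)
    (hE : ∀ k < N, ((k + 1 : ℕ) : MvPolynomial (Fin n × Fin n) ℂ) * E (k + 1) =
      ∑ i ∈ Finset.range (k + 1), (-1) ^ i * E (k - i) * P i)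
    (L : List (ArithCircuit.Gate ℂ (Fin n × Fin n))) (K : ℕ → Finset (Fin n)) (ps : ℕ → ℕ)
    (hps : ∀ i < N, ps i < L.length ∧ K (ps i) = S₀ ∧
      (ArithCircuit.gateValues L).getD (ps i) 0 = P i)
    (hInv : Inv L K) :
    ∃ (L' : List (ArithCircuit.Gate ℂ (Fin n × Fin n))) (K' : ℕ → Finset (Fin n)), L <+: L' ∧
      (∀ t < L.length, K' t = K t) ∧ L'.length ≤ L.length + (N + 1) * (N + 1) ∧ Inv L' K' ∧
      ∃ t < L'.length, K' t = S₀ ∧ (ArithCircuit.gateValues L').getD t 0 = E N := by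
  suffices H : ∀ m ≤ N, ∃ (L' : List (ArithCircuit.Gate ℂ (Fin n × Fin n)))
      (K' : ℕ → Finset (Fin n)), L <+: L' ∧ (∀ t < L.length, K' t = K t) ∧
      L'.length ≤ L.length + 1 + m * (N + 1) ∧ Inv L' K' ∧
      ∃ es : ℕ → ℕ, ∀ k ≤ m, es k < L'.length ∧ K' (es k) = S₀ ∧
        (ArithCircuit.gateValues L').getD (es k) 0 = E k by
    obtain ⟨L', K', hpre, hagr, hlen, hInv', es, hes⟩ := H N le_rfl
    refine ⟨L', K', hpre, hagr, ?_, hInv', es N, hes N le_rfl⟩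
    nlinarith [hlen]
  intro m
  induction m with
  | zero =>
    intro _
    -- the constant gate `E 0 = 1`
    obtain ⟨hp, ha, hl, hlt, hK, hv⟩ := rowScanGates_append L K
      (.sum [((1 : ℂ), .const 1)]) S₀
    refine ⟨_, _, hp, ha, by simp, hhered L K _ _ hInv
      (by simp [ArithCircuit.Gate.args]) ?_ ?_ hS₀ ?_, fun _ => L.length, fun k hk => ?_⟩
    · simp only [ArithCircuit.Gate.fanIn, ArithCircuit.Gate.args, List.map_cons, List.map_nil,
        List.length_cons, List.length_nil]
      omega
    · intro u hu
      simp only [ArithCircuit.Gate.args, List.map_cons, List.map_nil, List.mem_cons,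
        List.not_mem_nil, or_false] at hu
      subst hu
      trivial
    · intro u hu
      simp only [ArithCircuit.Gate.args, List.map_cons, List.map_nil, List.mem_cons,
        List.not_mem_nil, or_false] at hu
      subst hu
      simp [SupportSymm.osupp]
    · obtain rfl : k = 0 := Nat.le_zero.1 hk
      refine ⟨hlt, hK, ?_⟩
      rw [hv, h0]
      simp [ArithCircuit.Gate.eval, ArithCircuit.Operand.eval]
  | succ m ih =>
    intro hm
    obtain ⟨L₁, K₁, hpre₁, hagr₁, hlen₁, hInv₁, es, hes⟩ := ih (Nat.le_of_succ_le hm)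
    -- the located `P i` persist in `L₁`
    have hps₁ : ∀ i < N, ps i < L₁.length ∧ K₁ (ps i) = S₀ ∧
        (ArithCircuit.gateValues L₁).getD (ps i) 0 = P i := fun i hi =>
      ⟨lt_of_lt_of_le (hps i hi).1 hpre₁.length_le,
        by rw [hagr₁ _ (hps i hi).1, (hps i hi).2.1],
        by rw [rowScanGates_getD_eq_of_prefix hpre₁ (hps i hi).1, (hps i hi).2.2]⟩
    -- the products `E (m - i) * P i`, `i ≤ m`
    obtain ⟨L₂, K₂, hpre₂, hagr₂, hlen₂, hInv₂, hprod⟩ := rowScanGates_iter (ι := Fin (m + 1))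
      (β := Unit) Inv (fun _ _ => S₀) (fun i _ => E (m - i) * P i) 1 L₁ K₁
      (fun i L' K' hpre' hagr' hInv' => by
        have hi : (i : ℕ) < N := lt_of_lt_of_le i.2 hm
        have hmi : m - i ≤ m := Nat.sub_le _ _
        obtain ⟨hp, ha, hl, hlt, hK, hv⟩ := rowScanGates_append L' K'
          (.prod [.gate (es (m - i)), .gate (ps i)]) S₀
        refine ⟨_, _, hp, ha, hl, hhered L' K' _ _ hInv' (by simp [ArithCircuit.Gate.args]) ?_ ?_
          hS₀ ?_, fun _ => ⟨L'.length, hlt, hK, ?_⟩⟩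
        · simp only [ArithCircuit.Gate.fanIn, ArithCircuit.Gate.args, List.length_cons,
            List.length_nil]
          omega
        · intro u hu
          simp only [ArithCircuit.Gate.args, List.mem_cons, List.not_mem_nil, or_false] at hu
          rcases hu with rfl | rfl
          · exact lt_of_lt_of_le (hes _ hmi).1 hpre'.length_le
          · exact lt_of_lt_of_le (hps₁ i hi).1 hpre'.length_le
        · intro u hu
          simp only [ArithCircuit.Gate.args, List.mem_cons, List.not_mem_nil, or_false] at hu
          rcases hu with rfl | rfl
          · simp only [SupportSymm.osupp]
            rw [hagr' _ (hes _ hmi).1, (hes _ hmi).2.1]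
          · simp only [SupportSymm.osupp]
            rw [hagr' _ (hps₁ i hi).1, (hps₁ i hi).2.1]
        · rw [hv]
          simp only [ArithCircuit.Gate.eval, List.map_cons, List.map_nil, List.prod_cons,
            List.prod_nil, mul_one, ArithCircuit.Operand.eval_gate]
          rw [rowScanGates_getD_eq_of_prefix hpre' (hes _ hmi).1, (hes _ hmi).2.2,
            rowScanGates_getD_eq_of_prefix hpre' (hps₁ i hi).1, (hps₁ i hi).2.2])
      hInv₁
    choose pr hpr using fun i => hprod i ()
    -- the weighted sum gate `E (m + 1)`
    obtain ⟨hp, ha, hl, hlt, hK, hv⟩ := rowScanGates_append L₂ K₂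
      (.sum (((0 : ℂ), .const 0) :: List.ofFn fun i : Fin (m + 1) =>
        ((-1 : ℂ) ^ (i : ℕ) / ((m : ℂ) + 1), .gate (pr i)))) S₀
    have hm1 : ((m : ℂ) + 1) ≠ 0 := by exact_mod_cast Nat.succ_ne_zero m
    have hC : ((m + 1 : ℕ) : MvPolynomial (Fin n × Fin n) ℂ) = C ((m : ℂ) + 1) := by
      rw [← map_natCast C (m + 1), Nat.cast_succ]
    have hterm : ∀ i : ℕ, ((-1 : ℂ) ^ i / ((m : ℂ) + 1)) • (E (m - i) * P i) =
        C (((m : ℂ) + 1)⁻¹) * ((-1) ^ i * E (m - i) * P i) := by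
      intro i
      rw [smul_eq_C_mul, div_eq_inv_mul, C_mul, C_pow, C_neg, C_1]
      ring
    have hval : (ArithCircuit.Gate.sum (((0 : ℂ), .const 0) :: List.ofFn fun i : Fin (m + 1) =>
        ((-1 : ℂ) ^ (i : ℕ) / ((m : ℂ) + 1), .gate (pr i)))).eval (ArithCircuit.gateValues L₂) =
        E (m + 1) := by
      simp only [ArithCircuit.Gate.eval, List.map_cons, List.map_ofFn, List.sum_cons, zero_smul,
        zero_add, List.sum_ofFn, Function.comp_apply, ArithCircuit.Operand.eval_gate]
      rw [Finset.sum_congr rfl fun (i : Fin (m + 1)) _ => by rw [(hpr i).2.2, hterm],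
        ← Finset.mul_sum,
        Fin.sum_univ_eq_sum_range (fun i => (-1) ^ i * E (m - i) * P i) (m + 1),
        ← hE m (by omega), hC, ← mul_assoc, ← C_mul, inv_mul_cancel₀ hm1, C_1, one_mul]
    refine ⟨_, _, (hpre₁.trans hpre₂).trans hp, fun t ht => ?_, ?_,
      hhered L₂ K₂ _ _ hInv₂ (by simp [ArithCircuit.Gate.args]) ?_ ?_ hS₀ ?_,
      Function.update es (m + 1) L₂.length, fun k hk => ?_⟩
    · rw [ha t (lt_of_lt_of_le ht (hpre₁.trans hpre₂).length_le),
        hagr₂ t (lt_of_lt_of_le ht hpre₁.length_le), hagr₁ t ht]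
    · rw [Fintype.card_fin] at hlen₂
      have h := hl
      nlinarith [hl, hlen₂, hlen₁, hm]
    · simp only [ArithCircuit.Gate.fanIn, ArithCircuit.Gate.args, List.map_cons, List.map_ofFn,
        List.length_cons, List.length_ofFn]
      omega
    · intro u hu
      simp only [ArithCircuit.Gate.args, List.map_cons, List.map_ofFn, List.mem_cons,
        List.mem_ofFn, Function.comp_apply] at hu
      rcases hu with rfl | ⟨i, rfl⟩
      · trivial
      · exact (hpr i).1
    · intro u hu
      simp only [ArithCircuit.Gate.args, List.map_cons, List.map_ofFn, List.mem_cons,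
        List.mem_ofFn, Function.comp_apply] at hu
      rcases hu with rfl | ⟨i, rfl⟩
      · simp [SupportSymm.osupp]
      · simp only [SupportSymm.osupp]
        exact (hpr i).2.1.le
    · rcases Nat.lt_or_ge k (m + 1) with hk' | hk'
      · have hkm : k ≤ m := Nat.lt_succ_iff.1 hk'
        rw [Function.update_of_ne (Nat.ne_of_lt hk')]
        refine ⟨lt_of_lt_of_le (hes k hkm).1 (hpre₂.trans hp).length_le, ?_, ?_⟩
        · rw [ha _ (lt_of_lt_of_le (hes k hkm).1 hpre₂.length_le),
            hagr₂ _ (hes k hkm).1, (hes k hkm).2.1]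
        · rw [rowScanGates_getD_eq_of_prefix (hpre₂.trans hp) (hes k hkm).1, (hes k hkm).2.2]
      · obtain rfl : k = m + 1 := le_antisymm hk hk'
        rw [Function.update_self]
        exact ⟨hlt, hK, by rw [hv, hval]⟩

end Gadgets

/-! ### Registered sub-goal -/

/-- **Newton's recursion as gates (registered sub-goal, closed form of `blockGadgets_newton`).**
For every invariant `Inv` of annotated gate lists closed under appending hereditary gates of
fan-in `≤ A` and support width `≤ w`: if `E_0 = 1`, `(k+1) E_{k+1} = Σ_{i ≤ k} (-1)^i E_{k-i} P_i`
(`k < N`) and `P_0, …, P_{N-1}` are located at a common support `S₀`, then at most `(N + 1)²`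
more gates locate `E_N` at support `S₀`. [cite: Macdonald1995, I.(2.11')] -/
theorem blockGadgets_newton_located : ∀ (n A w : ℕ)
    (Inv : List (Literature.Computability.AlgebraicComplexity.ArithCircuit.Gate ℂ (Fin n × Fin n)) →
      (ℕ → Finset (Fin n)) → Prop),
    (∀ (L : List (Literature.Computability.AlgebraicComplexity.ArithCircuit.Gate ℂ (Fin n × Fin n)))
      (K : ℕ → Finset (Fin n))
      (g : Literature.Computability.AlgebraicComplexity.ArithCircuit.Gate ℂ (Fin n × Fin n))
      (S : Finset (Fin n)), Inv L K → g.args ≠ [] → g.fanIn ≤ A →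
      (∀ u ∈ g.args, u.RefsBelow L.length) → S.card ≤ w →
      (∀ u ∈ g.args, Literature.Computability.AlgebraicComplexity.SupportSymm.osupp K u ⊆ S) →
      Inv (L ++ [g]) (Function.update K L.length S)) →
    ∀ (N : ℕ), N + 2 ≤ A → ∀ (S₀ : Finset (Fin n)), S₀.card ≤ w →
    ∀ (E P : ℕ → MvPolynomial (Fin n × Fin n) ℂ), E 0 = 1 →
    (∀ k < N, ((k + 1 : ℕ) : MvPolynomial (Fin n × Fin n) ℂ) * E (k + 1) =
      ∑ i ∈ Finset.range (k + 1), (-1) ^ i * E (k - i) * P i) →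
    ∀ (L : List (Literature.Computability.AlgebraicComplexity.ArithCircuit.Gate ℂ (Fin n × Fin n)))
      (K : ℕ → Finset (Fin n)) (ps : ℕ → ℕ),
    (∀ i < N, ps i < L.length ∧ K (ps i) = S₀ ∧
      (Literature.Computability.AlgebraicComplexity.ArithCircuit.gateValues L).getD (ps i) 0 =
        P i) →
    Inv L K →
    ∃ (L' : List (Literature.Computability.AlgebraicComplexity.ArithCircuit.Gate ℂ (Fin n × Fin n)))
      (K' : ℕ → Finset (Fin n)), L <+: L' ∧ (∀ t < L.length, K' t = K t) ∧
      L'.length ≤ L.length + (N + 1) * (N + 1) ∧ Inv L' K' ∧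
      ∃ t < L'.length, K' t = S₀ ∧
        (Literature.Computability.AlgebraicComplexity.ArithCircuit.gateValues L').getD t 0 = E N :=
  fun _ A w Inv hhered => blockGadgets_newton A w Inv hhered

end Summit.ValiantsHypothesis.ValiantsHypothesis.Theorems
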